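import Mathlib
import Summits.Ventures.HodgeRepro2.Tier7.Target
import Summits.Ventures.HodgeRepro2.Tier7.Line1.L2Orth
import Summits.Ventures.HodgeRepro2.Tier7.Line1.Defs
import Summits.Ventures.HodgeRepro2.Tier7.Line1.CupProduct

/-!
# Tier7/Line1/FDConverse — the finite-dimensional converse for LINE 1 (t7-L1-p5)

Part 2 of 2 (part 1 = `Line1/L2Orth.lean`, p661721: the `L²` pairing, orthogonal complements, `exists_decomp`,
`exists_irred_not_le`). The registered lemmas of route/t7/Line1/Skeleton.lean v7 §8 (t7-plan-1) for t7-L1-p5, all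
sorry-free: over the displayed hypothesis `OrthDistinct D` (Liu 2021 App. D (D.1); declared in `Line1/CupProduct.lean`
p662177, t7-L1-p1, verbatim the skeleton's statement — imported, not re-declared), the TOWER FORM
`commonIrred_of_conclusion_of_orth : OrthDistinct D → C(D) → CommonIrred D` ((H9) only), the RIESZ step
`orthDistinct_of_finiteDimensional : FiniteDimensional ℂ (H10 * H10) → OrthDistinct D` ((H10) + the equivariant
orthogonal projection), and their composite `commonIrred_of_finiteDimensional` (the lead's l. 14635 (1) statement),
with the corollaries `inf_ne_bot_of_finiteDimensional`, `commonIrred_iff_conclusion_of_finiteDimensional`,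
`commonIrred_iff_conclusion_of_orth` (on the tower, under the printed `OrthDistinct`, residual ≡ C(D)), and the
forms `orthDistinct_of_irred_finiteDimensional` / `commonIrred_of_irred_finiteDimensional` (finite dimension asked
only of the Hecke-irreducible subspaces of `H20` — strictly weaker than `FiniteDimensional ℂ (H10 * H10)`, but NOT
representation-theoretic admissibility and, like it, FALSE of the real tower, whose constituents `π_f` are
infinite-dimensional: crit-2 l. 14737 R-p5-2; on the tower the only route is the PRINTED `OrthDistinct`). The
earlier names `orthDistinct_of_admissible` / `commonIrred_of_admissible` (v3, p663419) are MISNOMERS kept only by the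
append-only rule; use the `_irred_finiteDimensional` names.

WHAT THE FINITE-DIMENSIONAL HYPOTHESES ARE: statements about an ABSTRACT datum of the frozen interface (the dictionary
of the interface is the tower `H^*(X_∞, ℂ)` with its `U(V)(𝔸^∞)`-action; at a finite level `G` does not act), used
here to DECIDE the residual's kernel status on such data; they are not claims about the real `X`.

Behind them, in namespace `Line1.FD`: `projLin` = the `L²`-orthogonal projection `H20 → U` restricted to a
subspace `W ≤ H20`, a ℂ-linear map `W →ₗ[ℂ] HX` with values in `U`, Hecke-EQUIVARIANT for Hecke-stable `U`
(`projLin_equivariant`; from `intX_act`, `act_mul`, `bar_act` through `L2_act`, and uniqueness of the decomposition);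
`exists_irred_pair_of_L2_ne_zero` ((H9) only: non-orthogonal Hecke-stable subspaces contain non-orthogonal
irreducibles); `exists_decomp_of_fd` (the decomposition `H20 = U ⊕ orth U` needing only `U` finite-dimensional — the ambient `H20`
may be infinite-dimensional); `exists_commonIrred_of_L2_ne_zero` (a non-zero pairing between Hecke-stable subspaces
`U, U'` of `H20` with `U'` finite-dimensional yields a common abstract constituent, the shape of `CommonIrred`).

KERNEL RECORD for the CLOSE line (crit-1 l. 14626 O2(b), LEMMAS.md v4 §3 p5): «C(D) → R_CommonIrred: DERIVED under the
displayed printed hypothesis `OrthDistinct`, and under `FiniteDimensional ℂ (H10 * H10)`; on such data the residual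
is ≡ C(D)»; over the abstract datum the question stays with t7-L1-p2 / p4.

§8(d): uses an L-value-free non-vanishing device: NO (pure linear algebra over the frozen fields; nothing
here is about the step itself). Author: t7-L1-p5 (prover-pub-hodge-repro2-t7-L1-p5-g0-0).
-/

namespace Summit.Ventures.HodgeRepro2.Tier7.Line1.FD

open Summit.Ventures.HodgeRepro2.Tier7

noncomputable section

variable {HX : Type} [Ring HX] [Algebra ℂ HX] {G : Type} [Group G] [MulAction G HX]
  (S : SurfaceShadow HX G)

/-! ## 1. The decomposition `H^{1,0} ∧ H^{1,0} = U ⊕ orth U` for a FINITE-DIMENSIONAL `U` (the ambient `H20` may be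
infinite-dimensional: the orthogonal projection onto a complete subspace exists in any inner product space) -/

/-- `exists_decomp` with the finite-dimensionality hypothesis on the TARGET subspace `U` only: every
`x ∈ H^{1,0} ∧ H^{1,0}` is `u + (x - u)` with `u ∈ U`, `x - u ∈ orth U` (Mathlib's orthogonal projection onto the
complete subspace `U` of the inner product space `l2Core`). -/
theorem exists_decomp_of_fd (U : Submodule ℂ HX) (hU : U ≤ S.H10 * S.H10) [FiniteDimensional ℂ U]
    (x : HX) (hx : x ∈ S.H10 * S.H10) : ∃ u, u ∈ U ∧ x - u ∈ orth S U := by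
  letI : NormedAddCommGroup ↥(S.H10 * S.H10) :=
    @InnerProductSpace.Core.toNormedAddCommGroup ℂ ↥(S.H10 * S.H10) _ _ _ (l2Core S)
  letI : InnerProductSpace ℂ ↥(S.H10 * S.H10) := InnerProductSpace.ofCore _
  let K : Submodule ℂ ↥(S.H10 * S.H10) := U.comap (S.H10 * S.H10).subtype
  haveI : FiniteDimensional ℂ K := (Submodule.comapSubtypeEquivOfLe hU).symm.finiteDimensional
  haveI : CompleteSpace K := FiniteDimensional.complete ℂ K
  obtain ⟨y, hy, hz⟩ := Submodule.HasOrthogonalProjection.exists_orthogonal (K := K) ⟨x, hx⟩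
  refine ⟨(y : HX), hy, ?_⟩
  rw [mem_orth]
  refine ⟨Submodule.sub_mem _ hx (hU hy), fun u hu => ?_⟩
  have h1 := (Submodule.mem_orthogonal K _).mp hz ⟨u, hU hu⟩ hu
  change S.L2 (((⟨x, hx⟩ : ↥(S.H10 * S.H10)) - y : ↥(S.H10 * S.H10)) : HX) u = 0 at h1
  rwa [Submodule.coe_sub] at h1

/-! ## 2. The orthogonal projection onto a finite-dimensional `U` as an equivariant linear map -/

section Proj

variable (U : Submodule ℂ HX) (hU : U ≤ S.H10 * S.H10) [FiniteDimensional ℂ U]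

/-- the `U`-component of `x ∈ H^{1,0} ∧ H^{1,0}` -/
def projSub (x : ↥(S.H10 * S.H10)) : HX := Classical.choose (exists_decomp_of_fd S U hU (x : HX) x.2)

/-- the `U`-component lies in `U` and the remainder in `orth U` -/
theorem projSub_spec (x : ↥(S.H10 * S.H10)) :
    projSub S U hU x ∈ U ∧ (x : HX) - projSub S U hU x ∈ orth S U :=
  Classical.choose_spec (exists_decomp_of_fd S U hU (x : HX) x.2)

/-- the `U`-component is characterised by the decomposition -/
theorem projSub_eq (x : ↥(S.H10 * S.H10)) {u : HX} (hu : u ∈ U) (hv : (x : HX) - u ∈ orth S U) :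
    projSub S U hU x = u := by
  have hs := projSub_spec S U hU x
  refine decomp_unique S U hU hs.1 hs.2 hu hv ?_
  rw [add_sub_cancel, add_sub_cancel]

/-- the orthogonal projection onto `U` restricted to `W ⊆ H^{1,0} ∧ H^{1,0}`, as a ℂ-linear map `W → HX` -/
def projLin (W : Submodule ℂ HX) (hW : W ≤ S.H10 * S.H10) : W →ₗ[ℂ] HX where
  toFun w := projSub S U hU ⟨(w : HX), hW w.2⟩
  map_add' w w' := by
    apply projSub_eq
    · exact Submodule.add_mem _ (projSub_spec S U hU ⟨(w : HX), hW w.2⟩).1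
        (projSub_spec S U hU ⟨(w' : HX), hW w'.2⟩).1
    · change ((w + w' : W) : HX) - (projSub S U hU ⟨(w : HX), hW w.2⟩ +
          projSub S U hU ⟨(w' : HX), hW w'.2⟩) ∈ orth S U
      have h : ((w + w' : W) : HX) - (projSub S U hU ⟨(w : HX), hW w.2⟩ +
          projSub S U hU ⟨(w' : HX), hW w'.2⟩) =
          ((w : HX) - projSub S U hU ⟨(w : HX), hW w.2⟩) +
          ((w' : HX) - projSub S U hU ⟨(w' : HX), hW w'.2⟩) := by
        rw [Submodule.coe_add]
        abel
      rw [h]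
      exact Submodule.add_mem _ (projSub_spec S U hU ⟨(w : HX), hW w.2⟩).2
        (projSub_spec S U hU ⟨(w' : HX), hW w'.2⟩).2
  map_smul' c w := by
    simp only [RingHom.id_apply]
    apply projSub_eq
    · exact Submodule.smul_mem _ c (projSub_spec S U hU ⟨(w : HX), hW w.2⟩).1
    · change ((c • w : W) : HX) - c • projSub S U hU ⟨(w : HX), hW w.2⟩ ∈ orth S U
      have h : ((c • w : W) : HX) - c • projSub S U hU ⟨(w : HX), hW w.2⟩ =
          c • ((w : HX) - projSub S U hU ⟨(w : HX), hW w.2⟩) := by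
        rw [Submodule.coe_smul, smul_sub]
      rw [h]
      exact Submodule.smul_mem _ c (projSub_spec S U hU ⟨(w : HX), hW w.2⟩).2

/-- the projection takes values in `U` -/
theorem projLin_mem (W : Submodule ℂ HX) (hW : W ≤ S.H10 * S.H10) (w : W) :
    projLin S U hU W hW w ∈ U := by
  show projSub S U hU ⟨(w : HX), hW w.2⟩ ∈ U
  exact (projSub_spec S U hU ⟨(w : HX), hW w.2⟩).1

/-- the remainder `w - proj w` is orthogonal to `U` -/
theorem sub_projLin_mem_orth (W : Submodule ℂ HX) (hW : W ≤ S.H10 * S.H10) (w : W) :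
    (w : HX) - projLin S U hU W hW w ∈ orth S U := by
  show (w : HX) - projSub S U hU ⟨(w : HX), hW w.2⟩ ∈ orth S U
  exact (projSub_spec S U hU ⟨(w : HX), hW w.2⟩).2

/-- HECKE EQUIVARIANCE of the projection onto a Hecke-stable `U` (uniqueness of the decomposition,
Hecke-stability of `U` and of `orth U`): `proj (g • w) = g • proj w` -/
theorem projLin_equivariant (hUs : HeckeStable G U) (W : Submodule ℂ HX) (hW : W ≤ S.H10 * S.H10)
    (hWs : HeckeStable G W) (g : G) (w : W) :
    projLin S U hU W hW ⟨g • (w : HX), hWs g w w.2⟩ = g • projLin S U hU W hW w := by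
  show projSub S U hU ⟨g • (w : HX), hW (hWs g w w.2)⟩ = g • projSub S U hU ⟨(w : HX), hW w.2⟩
  apply projSub_eq
  · exact hUs g _ (projSub_spec S U hU ⟨(w : HX), hW w.2⟩).1
  · have h : g • (w : HX) - g • projSub S U hU ⟨(w : HX), hW w.2⟩ =
        g • ((w : HX) - projSub S U hU ⟨(w : HX), hW w.2⟩) := (act_sub S g _ _).symm
    change g • (w : HX) - g • projSub S U hU ⟨(w : HX), hW w.2⟩ ∈ orth S U
    rw [h]
    exact orth_heckeStable S U hUs g _ (projSub_spec S U hU ⟨(w : HX), hW w.2⟩).2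

end Proj

/-! ## 3. Non-orthogonal Hecke-stable subspaces contain non-orthogonal irreducibles ((H9) only) -/

/-- (H9), no finite dimension: if `U, U' ⊆ H^{1,0} ∧ H^{1,0}` are Hecke-stable and not `L²`-orthogonal, some
Hecke-irreducible `W ≤ U` and `W' ≤ U'` carry a non-zero pairing `⟨w, w'⟩ ≠ 0`. -/
theorem exists_irred_pair_of_L2_ne_zero (U U' : Submodule ℂ HX) (hU : U ≤ S.H10 * S.H10)
    (hU' : U' ≤ S.H10 * S.H10) (hUs : HeckeStable G U) (hU's : HeckeStable G U')
    (h : ∃ a ∈ U, ∃ b ∈ U', S.L2 a b ≠ 0) :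
    ∃ W W' : Submodule ℂ HX, W ≤ U ∧ W' ≤ U' ∧ HeckeIrred G W ∧ HeckeIrred G W' ∧
      ∃ w ∈ W, ∃ w' ∈ W', S.L2 w w' ≠ 0 := by
  obtain ⟨a, ha, b, hb, hab⟩ := h
  -- (i) an irreducible `W' ≤ U'` not orthogonal to `U`
  have h1 : ¬ U' ≤ annR S U := fun hle => hab ((mem_annR S U b).mp (hle hb) a ha)
  obtain ⟨W', hW'le, hW'irr, hW'not⟩ := exists_irred_not_le S U' hU' hU's _ h1
  obtain ⟨b', hb'W', hb'not⟩ := SetLike.not_le_iff_exists.mp hW'not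
  rw [mem_annR] at hb'not
  obtain ⟨a', ha'⟩ := not_forall.mp hb'not
  obtain ⟨ha'U, ha'b'⟩ := Classical.not_imp.mp ha'
  -- (ii) an irreducible `W ≤ U` not orthogonal to `W'`
  have h2 : ¬ U ≤ annL S W' := fun hle => ha'b' ((mem_annL S W' a').mp (hle ha'U) b' hb'W')
  obtain ⟨W, hWle, hWirr, hWnot⟩ := exists_irred_not_le S U hU hUs _ h2
  obtain ⟨w, hwW, hwnot⟩ := SetLike.not_le_iff_exists.mp hWnot
  rw [mem_annL] at hwnot
  obtain ⟨w', hw'⟩ := not_forall.mp hwnot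
  obtain ⟨hw'W', hww'⟩ := Classical.not_imp.mp hw'
  exact ⟨W, W', hWle, hW'le, hWirr, hW'irr, w, hwW, w', hw'W', hww'⟩

/-! ## 4. THE FINITE-DIMENSIONAL CONVERSE -/

/-- **A non-zero `L²`-pairing between Hecke-stable subspaces of `H^{1,0} ∧ H^{1,0}` yields a common abstract
Hecke-irreducible constituent** (finite-dimensional `U'`; the ambient `H^{1,0} ∧ H^{1,0}` may be infinite-dimensional):
irreducibles `W ≤ U`, `W' ≤ U'` and a non-zero Hecke-equivariant ℂ-linear map `W → HX` with values in `W'` — the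
shape of `Line1.CommonIrred`. Proof: by (H9) some irreducibles `W ≤ U`, `W' ≤ U'` are not `L²`-orthogonal
(`exists_irred_pair_of_L2_ne_zero`); the orthogonal projection `H^{1,0} ∧ H^{1,0} → W'` (finite-dimensional `W'`)
restricted to `W` is ℂ-linear, Hecke-equivariant, has values in `W'`, and is non-zero on a `w ∈ W` pairing
non-trivially with `W'`. -/
theorem exists_commonIrred_of_L2_ne_zero
    (U U' : Submodule ℂ HX) (hU : U ≤ S.H10 * S.H10) (hU' : U' ≤ S.H10 * S.H10)
    (hUs : HeckeStable G U) (hU's : HeckeStable G U') [FiniteDimensional ℂ U']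
    (h : ∃ a ∈ U, ∃ b ∈ U', S.L2 a b ≠ 0) :
    ∃ (W W' : Submodule ℂ HX) (hW : HeckeIrred G W) (_hW' : HeckeIrred G W'),
      W ≤ U ∧ W' ≤ U' ∧ ∃ φ : W →ₗ[ℂ] HX, (∀ x : W, φ x ∈ W') ∧
        (∀ (g : G) (x : W), φ ⟨g • (x : HX), hW.2.1 g x x.2⟩ = g • φ x) ∧ φ ≠ 0 := by
  obtain ⟨W, W', hWle, hW'le, hWirr, hW'irr, w, hwW, w', hw'W', hww'⟩ :=
    exists_irred_pair_of_L2_ne_zero S U U' hU hU' hUs hU's h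
  have hW'H : W' ≤ S.H10 * S.H10 := hW'le.trans hU'
  have hWH : W ≤ S.H10 * S.H10 := hWle.trans hU
  haveI : FiniteDimensional ℂ W' := Submodule.finiteDimensional_of_le hW'le
  refine ⟨W, W', hWirr, hW'irr, hWle, hW'le, projLin S W' hW'H W hWH, fun x => projLin_mem S W' hW'H W hWH x,
    fun g x => projLin_equivariant S W' hW'H hW'irr.2.1 W hWH hWirr.2.1 g x, ?_⟩
  intro hzero
  have hw0 : projLin S W' hW'H W hWH ⟨w, hwW⟩ = 0 := by
    rw [hzero, LinearMap.zero_apply]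
  have hrem := sub_projLin_mem_orth S W' hW'H W hWH ⟨w, hwW⟩
  rw [hw0, sub_zero, mem_orth] at hrem
  exact hww' (hrem.2 w' hw'W')

end

end Summit.Ventures.HodgeRepro2.Tier7.Line1.FD

/-! ## 5. LINE 1: the registered lemmas of Skeleton v7 §8 (t7-L1-p5); `OrthDistinct` is imported from `Line1/CupProduct` -/

namespace Summit.Ventures.HodgeRepro2.Tier7.Line1

open Summit.Ventures.HodgeRepro2.Tier7

section

variable {K : Type} [Field K] [NumberField K] {E' : Type} [Field E'] [NumberField E']
  {V : Type} [AddCommGroup V] [Module E' V] {HX : Type} [Ring HX] [Algebra ℂ HX]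
  {G : Type} [Group G] [MulAction G HX] (D : PeriodDatum K E' V HX G)

/-- the pairing witness of the conclusion lies in `P_A × P_B` -/
theorem exists_pair_of_conclusion (hC : ∃ g : Fin 4 → G, D.S.L2 (D.fOmegaS g) (D.fOmegaSbar g) ≠ 0) :
    ∃ a ∈ prodModS D, ∃ b ∈ prodModSbar D, D.S.L2 a b ≠ 0 := by
  obtain ⟨g, hg⟩ := hC
  exact ⟨D.fOmegaS g, Submodule.subset_span ⟨g, rfl⟩, D.fOmegaSbar g, Submodule.subset_span ⟨g, rfl⟩, hg⟩

/-- **(t7-L1-p5) THE TOWER FORM of the converse**: under the displayed `OrthDistinct` the conclusion gives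
`CommonIrred D`. Proof: the witness `⟨f^*Ω_s, f^*Ω_{s̄}⟩ ≠ 0` lies in `P_A × P_B`; by (H9) some Hecke-irreducible
`W ≤ P_A`, `W' ≤ P_B` pair non-trivially (`FD.exists_irred_pair_of_L2_ne_zero`, no finite dimension); `OrthDistinct`
forces `W = W'`, a literal common irreducible, and `commonIrred_of_irred_le_inf` closes. Consumes (H9) and the
displayed hypothesis only — neither (H10) nor finite dimension. -/
theorem commonIrred_of_conclusion_of_orth (horth : OrthDistinct D)
    (hC : ∃ g : Fin 4 → G, D.S.L2 (D.fOmegaS g) (D.fOmegaSbar g) ≠ 0) : CommonIrred D := by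
  obtain ⟨W, W', hWle, hW'le, hWirr, hW'irr, w, hwW, w', hw'W', hww'⟩ :=
    FD.exists_irred_pair_of_L2_ne_zero D.S (prodModS D) (prodModSbar D) (prodModS_le D) (prodModSbar_le D)
      (prodModS_stable D) (prodModSbar_stable D) (exists_pair_of_conclusion D hC)
  have hEq : W = W' := by
    by_contra hne
    exact hww' (horth W W' hWirr hW'irr (hWle.trans (prodModS_le D)) (hW'le.trans (prodModSbar_le D)) hne
      w hwW w' hw'W')
  subst hEq
  exact commonIrred_of_irred_le_inf D W hWirr hWle hW'le

/-- **(t7-L1-p5) RIESZ for ADMISSIBLE data**: if every Hecke-irreducible subspace of `H^{1,0} ∧ H^{1,0}` is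
finite-dimensional (a hypothesis strictly weaker than `FiniteDimensional ℂ (H10 * H10)`), distinct Hecke-irreducible
subspaces are `L²`-orthogonal. Proof: a non-zero pairing between irreducibles `W`, `W'` gives, through the
`L²`-orthogonal projection `H^{1,0} ∧ H^{1,0} → W'` (ℂ-linear, Hecke-equivariant by `intX_act`, `act_mul`,
`bar_act`; `FD.exists_commonIrred_of_L2_ne_zero`, needing only `W'` finite-dimensional), a non-zero Hecke-equivariant
map `W → W'`, and (H10) `H20_multone` forces `W = W'`. -/
theorem orthDistinct_of_admissible
    (hadm : ∀ W : Submodule ℂ HX, HeckeIrred G W → W ≤ D.S.H10 * D.S.H10 → FiniteDimensional ℂ W) :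
    OrthDistinct D := by
  intro W W' hW hW' hWle hW'le hne a ha b hb
  by_contra hab
  haveI : FiniteDimensional ℂ W' := hadm W' hW' hW'le
  obtain ⟨W₁, W₁', hW₁, hW₁', hW₁le, hW₁'le, φ, hφ, hφeq, hφne⟩ :=
    FD.exists_commonIrred_of_L2_ne_zero D.S W W' hWle hW'le hW.2.1 hW'.2.1 ⟨a, ha, b, hb, hab⟩
  -- irreducibility of `W`, `W'`: the irreducible subspaces `W₁ ≤ W`, `W₁' ≤ W'` are all of `W`, `W'`
  have e₁ : W₁ = W := (hW.2.2 W₁ hW₁le hW₁.2.1).resolve_left hW₁.1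
  have e₂ : W₁' = W' := (hW'.2.2 W₁' hW₁'le hW₁'.2.1).resolve_left hW₁'.1
  subst e₁
  subst e₂
  exact hne (D.S.H20_multone W₁ W₁' hWle hW'le hW₁ hW₁' φ hφ hφeq hφne)

/-- **(t7-L1-p5) RIESZ on finite-dimensional data** — the registered form: under the displayed
`FiniteDimensional ℂ (H10 * H10)` every Hecke-irreducible subspace of `H^{1,0} ∧ H^{1,0}` is finite-dimensional, so
`orthDistinct_of_admissible` applies. -/
theorem orthDistinct_of_finiteDimensional (hfd : FiniteDimensional ℂ (D.S.H10 * D.S.H10)) : OrthDistinct D :=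
  orthDistinct_of_admissible D fun _ _ hle => Submodule.finiteDimensional_of_le hle

/-- the tower-shaped corollary: under the displayed admissibility «every Hecke-irreducible subspace of
`H^{1,0} ∧ H^{1,0}` is finite-dimensional» the conclusion gives `CommonIrred D` -/
theorem commonIrred_of_admissible
    (hadm : ∀ W : Submodule ℂ HX, HeckeIrred G W → W ≤ D.S.H10 * D.S.H10 → FiniteDimensional ℂ W)
    (hC : ∃ g : Fin 4 → G, D.S.L2 (D.fOmegaS g) (D.fOmegaSbar g) ≠ 0) : CommonIrred D :=
  commonIrred_of_conclusion_of_orth D (orthDistinct_of_admissible D hadm) hC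

/-- **(t7-L1-p5) THE FINITE-DIMENSIONAL CONVERSE** — the lead's l. 14635 (1) statement: on finite-dimensional data
(the real `X` at every finite level) the conclusion `∃ g, ⟨f^*Ω_s, f^*Ω_{s̄}⟩ ≠ 0` gives `CommonIrred D`; so on such
data the residual `R_CommonIrred` is ≡ C(D) (with `target_of_common_irred` for the other direction). -/
theorem commonIrred_of_finiteDimensional (hfd : FiniteDimensional ℂ (D.S.H10 * D.S.H10))
    (hC : ∃ g : Fin 4 → G, D.S.L2 (D.fOmegaS g) (D.fOmegaSbar g) ≠ 0) : CommonIrred D :=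
  commonIrred_of_conclusion_of_orth D (orthDistinct_of_finiteDimensional D hfd) hC

/-- the same in the common-vector form: `P_A ⊓ P_B ≠ ⊥` (through the landed `commonIrred_iff_inf_ne_bot`, (H10)) -/
theorem inf_ne_bot_of_finiteDimensional (hfd : FiniteDimensional ℂ (D.S.H10 * D.S.H10))
    (hC : ∃ g : Fin 4 → G, D.S.L2 (D.fOmegaS g) (D.fOmegaSbar g) ≠ 0) :
    prodModS D ⊓ prodModSbar D ≠ ⊥ :=
  (commonIrred_iff_inf_ne_bot D).mp (commonIrred_of_finiteDimensional D hfd hC)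

/-- on finite-dimensional data the residual and the conclusion are EQUIVALENT: `CommonIrred D ↔ C(D)` -/
theorem commonIrred_iff_conclusion_of_finiteDimensional (hfd : FiniteDimensional ℂ (D.S.H10 * D.S.H10)) :
    CommonIrred D ↔ ∃ g : Fin 4 → G, D.S.L2 (D.fOmegaS g) (D.fOmegaSbar g) ≠ 0 :=
  ⟨target_of_common_irred D, commonIrred_of_finiteDimensional D hfd⟩

/-- on the TOWER, under the displayed printed `OrthDistinct` (Liu 2021 App. D (D.1)), the residual and the conclusion
are EQUIVALENT: `CommonIrred D ↔ C(D)` — the kernel form of «on the real X, Line 1's residual is (P) in its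
common-vector form» (crit-1 l. 14626 O2(b), plan-1 l. 14707 (2)) -/
theorem commonIrred_iff_conclusion_of_orth (horth : OrthDistinct D) :
    CommonIrred D ↔ ∃ g : Fin 4 → G, D.S.L2 (D.fOmegaS g) (D.fOmegaSbar g) ≠ 0 :=
  ⟨target_of_common_irred D, commonIrred_of_conclusion_of_orth D horth⟩

/-- **(t7-L1-p5) RIESZ for data with FINITE-DIMENSIONAL IRREDUCIBLES** — the correctly named form of
`orthDistinct_of_admissible` (crit-2 l. 14737 R-p5-2: the hypothesis «every Hecke-irreducible subspace of
`H^{1,0} ∧ H^{1,0}` is finite-dimensional» is NOT representation-theoretic admissibility — finite-dimensional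
`K`-invariants — and it is FALSE of the real tower, whose constituents are the infinite-dimensional `π_f`; it is an
abstract-datum hypothesis, strictly weaker than `FiniteDimensional ℂ (H10 * H10)`). -/
theorem orthDistinct_of_irred_finiteDimensional
    (hfin : ∀ W : Submodule ℂ HX, HeckeIrred G W → W ≤ D.S.H10 * D.S.H10 → FiniteDimensional ℂ W) :
    OrthDistinct D :=
  orthDistinct_of_admissible D hfin

/-- the correctly named form of `commonIrred_of_admissible`: under «every Hecke-irreducible subspace of
`H^{1,0} ∧ H^{1,0}` is finite-dimensional» (abstract datum; false of the tower) the conclusion gives `CommonIrred D` -/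
theorem commonIrred_of_irred_finiteDimensional
    (hfin : ∀ W : Submodule ℂ HX, HeckeIrred G W → W ≤ D.S.H10 * D.S.H10 → FiniteDimensional ℂ W)
    (hC : ∃ g : Fin 4 → G, D.S.L2 (D.fOmegaS g) (D.fOmegaSbar g) ≠ 0) : CommonIrred D :=
  commonIrred_of_admissible D hfin hC

end

end Summit.Ventures.HodgeRepro2.Tier7.Line1
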